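import Literature.NumberTheory.EllipticCurves.OrdinaryReductionTorsionLineProofs
import HarnessLib

/-!
# Crux `GoodLatticeBDPValue` (stmt-BirchSwinnertonDyer-19032), line `halves`, AN-3 Stub B road — brick F3a:
# the kernel of reduction on `E[p^r]` at a good ORDINARY place above `p` (count `p^r` and a generator)

Width seat bsd-line-x1-p1-w3 (gen 4). HONEST FRAMING (cell `bsd-eis`, run/shared/lean/pub/bsd-eis/):
TOOL THEOREM ONLY (no `def`, no named fact, no `sorry`); nothing about a summit statement,
Keller–Yin Thm. 2.2.2 or crux 2 is proved here; 0 stubs / cells / labels move.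

WHY (road memo `HOME/line-x1-p1-w3-g4/AN3-StubB-elementary-road.md`, evidence #44 on the item,
steps A2/A3/A5 at the prime `3`): the elementary proof of Theorem T′
(`HalvesAnThreeSplit.FullDescentAtThreeOfRed`) needs, at the good ordinary prime `p = 3`, the
LEVEL-`9` kernel of reduction `K₉ = ker(E[9] → Ẽ(k̄)) = Ê[9]`: cyclic of order `9`, with
`K₉ ∩ E[3] = Λ₃` (Serre's line `X_3`), stable under the decomposition group, the inertia group
acting trivially on `E[9]/K₉`. The tree's `goodReduction_reduction_line`
(`OrdinaryReductionTorsionLineProofs`) builds the reduction map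
`f : E(K̄) → MO~(k̄_w)` from the local good model (`exists_goodReduction_localModel`) and proves
kernel-stability, inertia-invariance (`f (res τ • a) = f a`, ALL `a`) and the count
`#(ker f ∩ E[p]) = p`. This file adds, for the SAME `f` and every `r`, the count
**`#(ker f ∩ E[p^r]) = p^r`** together with a GENERATOR of order `p^r` of `ker f ∩ E[p^r]` (so it
is cyclic): Steps 6–7 of loc. cit. replayed at level `p^r`, the local input being the tree's
ordinary filtration `natCard_torsionBy_ker_goodReductionHom_eq … r` /
`exists_generator_torsionBy_ker_goodReductionHom … r` (`OrdinaryReductionKernelTorsionProofs` §5,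
Greenberg LNM 1716 §1 p. 62: `ℱ[p^∞] ≅ ℚ_p/ℤ_p`).

* `natCard_ker_inf_geomTorsion_pow` — hypotheses VERBATIM those of `goodReduction_reduction_line`
  (minus the equivariance clause `hΦ₀`, not needed for counting) plus `r : ℕ`; conclusion `Nat.card ↥(f.ker ⊓ E[p^r]) = p^r ∧ ∃ x ∈ f.ker ⊓ E[p^r], addOrderOf x = p^r ∧
  ∀ y ∈ f.ker ⊓ E[p^r], ∃ c : ℕ, y = c • x`.

References: [SerreInventiones1972] §1.11 Prop. 11 and Cor.; [GreenbergLNM1716] §1 p. 62, §2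
Props. 2.2, 2.4; [SilvermanAEC2009] Prop. VII.2.1, VII.3.1, Cor. III.6.4.
-/

noncomputable section

open scoped Classical NNReal NumberField AddSubgroup
open NumberField IsDedekindDomain Polynomial

set_option autoImplicit false
set_option linter.dupNamespace false

namespace Summit.BirchSwinnertonDyer.BirchSwinnertonDyer.Theorems.FullDescentOrdinary

open _root_.WeierstrassCurve Literature.NumberTheory.EllipticCurves Literature.NumberTheory.GaloisRepresentations
  Field IsDedekindDomain.HeightOneSpectrum

/-- **The kernel of reduction on `E[p^r]` at a good ordinary place above `p`: `p^r` points and a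
generator of order `p^r`** (Serre 1972 §1.11 "bonne réduction de hauteur 1"; Greenberg LNM 1716 §1
p. 62, `ℱ[p^∞] ≅ ℚ_p/ℤ_p`). Hypotheses VERBATIM those of the tree's `goodReduction_reduction_line`
(the reduction map `f` of the good local model; its equivariance clause `hΦ₀` is not needed here), plus the level `r`.
[cite: SerreInventiones1972, §1.11 Prop. 11 and Cor.] [cite: GreenbergLNM1716, §1 p. 62]
[cite: SilvermanAEC2009, Prop. VII.2.1, VII.3.1] -/
theorem natCard_ker_inf_geomTorsion_pow {K : Type} [Field K] [NumberField K]
    (W : WeierstrassCurve K) [W.IsElliptic] (p : ℕ) [hp : Fact p.Prime]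
    (v : HeightOneSpectrum (𝓞 K)) (hpv : (p : 𝓞 K) ∈ v.asIdeal) (hgood : W.HasGoodReductionAt v)
    (hord : ¬ ((p : ℤ) ∣ W.frobeniusTraceAt v))
    {w : Valuation (AlgebraicClosure (v.adicCompletion K)) ℝ≥0}
    (hw : ∀ x, (w x : ℝ) =
      spectralNorm (v.adicCompletion K) (AlgebraicClosure (v.adicCompletion K)) x)
    {φ : v.adicCompletionIntegers K →+* w.valuationSubring}
    (hΔO : IsUnit ((W.localMinimalIntegralModel v).map φ).Δ)
    (hX : ((W.localMinimalIntegralModel v).map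
        (algebraMap (v.adicCompletionIntegers K) (v.adicCompletion K))).baseChange
          (AlgebraicClosure (v.adicCompletion K)) =
        ((W.localMinimalIntegralModel v).map φ).baseChange (AlgebraicClosure (v.adicCompletion K)))
    (Φ₀ : localPoints W (v.adicCompletion K) ≃+
      (((W.localMinimalIntegralModel v).map
        (algebraMap (v.adicCompletionIntegers K) (v.adicCompletion K))).baseChange
          (AlgebraicClosure (v.adicCompletion K))).toAffine.Point)
    (f : geomPoints W →+
      (((W.localMinimalIntegralModel v).map φ).map (IsLocalRing.residue w.valuationSubring)).toAffine.Point)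
    (hf : ∀ a, f a = goodReductionHom ((W.localMinimalIntegralModel v).map φ)
      (Valuation.valuationSubring.integers w) hΔO
      (Affine.Point.congrEquiv hX (Φ₀ (pointsMap W (v.adicCompletion K) a)))) (r : ℕ) :
    Nat.card ↥(f.ker ⊓ geomTorsion W ((p ^ r : ℕ) : ℤ)) = p ^ r ∧
      ∃ x : geomPoints W, x ∈ f.ker ⊓ geomTorsion W ((p ^ r : ℕ) : ℤ) ∧ addOrderOf x = p ^ r ∧
        ∀ y ∈ f.ker ⊓ geomTorsion W ((p ^ r : ℕ) : ℤ), ∃ c : ℕ, y = c • x := by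
  haveI : CharZero (v.adicCompletion K) :=
    charZero_of_injective_algebraMap (algebraMap K (v.adicCompletion K)).injective
  haveI : CharZero (AlgebraicClosure (v.adicCompletion K)) :=
    charZero_of_injective_algebraMap
      (algebraMap (v.adicCompletion K) (AlgebraicClosure (v.adicCompletion K))).injective
  have hvO : w.Integers w.valuationSubring := Valuation.valuationSubring.integers w
  haveI hMOell : ((W.localMinimalIntegralModel v).map φ).IsElliptic := ⟨hΔO⟩
  have hEv : W.reductionAt v = (W.localMinimalIntegralModel v).map
      (IsLocalRing.residue (v.adicCompletionIntegers K)) := rfl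
  set red := goodReductionHom ((W.localMinimalIntegralModel v).map φ) hvO hΔO with hreddef
  /- residue characteristic `p` on both sides -/
  have hpO : w ((p : ℕ) : AlgebraicClosure (v.adicCompletion K)) < 1 := by
    have h := spectralValuation_algebraMap_ringOfIntegers_lt_one (v := v) hw hpv
    rwa [map_natCast] at h
  haveI hchar : CharP (IsLocalRing.ResidueField w.valuationSubring) p := by
    refine (CharP.charP_iff_prime_eq_zero hp.out).mpr ?_
    rw [← map_natCast (IsLocalRing.residue w.valuationSubring), IsLocalRing.residue_eq_zero_iff,
      IsLocalRing.mem_maximalIdeal, mem_nonunits_iff, hvO.isUnit_iff_valuation_eq_one]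
    exact fun h ↦ absurd h (ne_of_lt (by simpa using hpO))
  haveI hcharv : CharP (IsLocalRing.ResidueField (v.adicCompletionIntegers K)) p := by
    refine (CharP.charP_iff_prime_eq_zero hp.out).mpr ?_
    have h := (residue_algebraMap_eq_zero_iff K v (p : 𝓞 K)).mpr hpv
    rwa [map_natCast, map_natCast] at h
  /- Step 2 ("good, ordinary"): some `p`-torsion point of `MO(K̄_v)` has non-zero reduction. -/
  haveI := isElliptic_reductionAt hgood
  have hdegE : ((W.reductionAt v).ΨSq p).natDegree ≠ 0 :=
    natDegree_ΨSq_ne_zero_of_not_dvd_trace (W.reductionAt v) p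
      (by rwa [frobeniusTraceAt_def] at hord)
  have hdegMO : ((((W.localMinimalIntegralModel v).map φ).ΨSq p).map
      (IsLocalRing.residue w.valuationSubring)).natDegree ≠ 0 := by
    rw [WeierstrassCurve.map_ΨSq]
    refine natDegree_map_map_residue_ne_zero φ _ ?_
    rwa [hEv, WeierstrassCurve.map_ΨSq] at hdegE
  have hordMO := exists_zsmul_eq_zero_goodReductionHom_ne_zero w.valuationSubring hvO hΔO p hdegMO
  have h5 := natCard_torsionBy_ker_goodReductionHom_eq w.valuationSubring hvO hΔO hordMO r
  obtain ⟨P₀, hP₀ker, hP₀ord, hP₀gen⟩ :=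
    exists_generator_torsionBy_ker_goodReductionHom w.valuationSubring hvO hΔO hordMO r
  /- Step 6: counting `#E[p^r] = p^{2r}` on both sides; all `p^r`-torsion of `E(K̄_v)` is algebraic. -/
  let Φ : localPoints W (v.adicCompletion K) ≃+
      (((W.localMinimalIntegralModel v).map φ).baseChange
        (AlgebraicClosure (v.adicCompletion K))).toAffine.Point :=
    Φ₀.trans (Affine.Point.congrEquiv hX)
  have hf' : ∀ a : geomPoints W, f a = red (Φ (pointsMap W (v.adicCompletion K) a)) :=
    fun a ↦ hf a
  have hpr0 : p ^ r ≠ 0 := pow_ne_zero r hp.out.ne_zero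
  have hcast : ((p ^ r : ℕ) : ℤ) = (p : ℤ) ^ r := Nat.cast_pow p r
  have hA : Nat.card (geomTorsion W ((p ^ r : ℕ) : ℤ)) = (p ^ r) ^ 2 :=
    card_torsionBy_eq_sq (E := W.baseChange (AlgebraicClosure K)) (n := p ^ r) (by exact_mod_cast hpr0)
  have hcardL : Nat.card ((localPoints W (v.adicCompletion K))[((p ^ r : ℕ) : ℤ)]) = (p ^ r) ^ 2 :=
    card_torsionBy_eq_sq (E := W.baseChange (AlgebraicClosure (v.adicCompletion K))) (n := p ^ r)
      (by exact_mod_cast hpr0)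
  haveI : Finite ((localPoints W (v.adicCompletion K))[((p ^ r : ℕ) : ℤ)]) :=
    Nat.finite_of_card_ne_zero (by rw [hcardL]; positivity)
  have hsurjL : ∀ Q ∈ (localPoints W (v.adicCompletion K))[((p ^ r : ℕ) : ℤ)],
      ∃ x ∈ geomTorsion W ((p ^ r : ℕ) : ℤ), pointsMap W (v.adicCompletion K) x = Q := fun Q hQ ↦
    exists_mem_torsionBy_eq_of_injective (pointsMap W (v.adicCompletion K))
      (pointsMapOfEmb_injective W (closureEmb (K := K) (v.adicCompletion K))) (p ^ r)
      (le_of_eq (by rw [hcardL, hA])) Q hQ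
  /- Step 7: `x ↦ Φ (pointsMap x)` is a bijection `ker f ∩ E[p^r] → ker red ∩ MO[p^r]`. -/
  have hker : Nat.card ((red.ker)[((p : ℤ) ^ r)]) = p ^ r := h5.1
  let g : ↥(f.ker ⊓ geomTorsion W ((p ^ r : ℕ) : ℤ)) → ↥((red.ker)[((p : ℤ) ^ r)]) := fun x ↦
    ⟨⟨Φ (pointsMap W (v.adicCompletion K) x), by
      have hx := (AddSubgroup.mem_inf.mp x.2).1
      rwa [AddMonoidHom.mem_ker, hf'] at hx⟩, by
      have hx := (AddSubgroup.mem_inf.mp x.2).2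
      rw [mem_torsionBy_iff] at hx ⊢
      refine Subtype.ext ?_
      change ((p : ℤ) ^ r) • Φ (pointsMap W (v.adicCompletion K) x) = 0
      rw [← hcast, ← map_zsmul, ← map_zsmul, hx, map_zero, map_zero]⟩
  have hgval : ∀ x : ↥(f.ker ⊓ geomTorsion W ((p ^ r : ℕ) : ℤ)),
      ((g x : ↥(red.ker)) : (((W.localMinimalIntegralModel v).map φ).baseChange
        (AlgebraicClosure (v.adicCompletion K))).toAffine.Point) =
        Φ (pointsMap W (v.adicCompletion K) x) := fun _ ↦ rfl
  have hg_inj : Function.Injective g := by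
    intro x y hxy
    have h1 : Φ (pointsMap W (v.adicCompletion K) x) = Φ (pointsMap W (v.adicCompletion K) y) :=
      congrArg (fun z : ↥((red.ker)[((p : ℤ) ^ r)]) ↦ (z.1.1)) hxy
    exact Subtype.ext (pointsMapOfEmb_injective W (closureEmb (K := K) (v.adicCompletion K))
      (Φ.injective h1))
  have hg_surj : Function.Surjective g := by
    rintro ⟨⟨P, hP⟩, hPp⟩
    rw [mem_torsionBy_iff] at hPp
    have hPp' : ((p : ℤ) ^ r) • P = 0 := congrArg Subtype.val hPp
    set Q := Φ.symm P with hQdef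
    have hQ : Q ∈ (localPoints W (v.adicCompletion K))[((p ^ r : ℕ) : ℤ)] := by
      rw [mem_torsionBy_iff, hQdef, ← map_zsmul, hcast, hPp', map_zero]
    obtain ⟨x, hx, hxQ⟩ := hsurjL Q hQ
    refine ⟨⟨x, AddSubgroup.mem_inf.mpr ⟨?_, hx⟩⟩, ?_⟩
    · rw [AddMonoidHom.mem_ker, hf', hxQ, hQdef, AddEquiv.apply_symm_apply]
      exact hP
    · refine Subtype.ext (Subtype.ext ?_)
      change Φ (pointsMap W (v.adicCompletion K) x) = P
      rw [hxQ, hQdef, AddEquiv.apply_symm_apply]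
  refine ⟨(Nat.card_eq_of_bijective g ⟨hg_inj, hg_surj⟩).trans hker, ?_⟩
  /- The generator: pull `P₀` back along the bijection `g`. -/
  have hP₀mem : (⟨P₀, by rwa [AddMonoidHom.mem_ker]⟩ : ↥(red.ker)) ∈ (red.ker)[((p : ℤ) ^ r)] := by
    rw [mem_torsionBy_iff]
    refine Subtype.ext ?_
    change ((p : ℤ) ^ r) • P₀ = 0
    rw [← hcast, natCast_zsmul, ← hP₀ord]
    exact addOrderOf_nsmul_eq_zero P₀
  obtain ⟨x₀, hx₀⟩ := hg_surj ⟨⟨P₀, by rwa [AddMonoidHom.mem_ker]⟩, hP₀mem⟩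
  have hx₀val : Φ (pointsMap W (v.adicCompletion K) x₀) = P₀ := by
    have := congrArg (fun z : ↥((red.ker)[((p : ℤ) ^ r)]) ↦ (z.1.1)) hx₀
    simpa [hgval] using this
  -- the injective additive map `ψ := Φ ∘ pointsMap`
  set ψ : geomPoints W →+ (((W.localMinimalIntegralModel v).map φ).baseChange
      (AlgebraicClosure (v.adicCompletion K))).toAffine.Point :=
    Φ.toAddMonoidHom.comp (pointsMap W (v.adicCompletion K)) with hψdef
  have hψ : ∀ a, ψ a = Φ (pointsMap W (v.adicCompletion K) a) := fun _ ↦ rfl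
  have hψinj : Function.Injective ψ := fun a b h ↦
    pointsMapOfEmb_injective W (closureEmb (K := K) (v.adicCompletion K)) (Φ.injective h)
  refine ⟨(x₀ : geomPoints W), x₀.2, ?_, ?_⟩
  · -- order is preserved by the injective hom `ψ`
    have h := addOrderOf_injective ψ hψinj (x₀ : geomPoints W)
    rw [hψ, hx₀val] at h
    rw [← h, hP₀ord]
  · intro y hy
    obtain ⟨hyker, hytor⟩ := AddSubgroup.mem_inf.mp hy
    have hyred : red (ψ y) = 0 := by
      rw [hψ, ← hf']; exact hyker
    have hytor' : ((p ^ r : ℕ) : ℤ) • ψ y = 0 := by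
      rw [← map_zsmul, mem_torsionBy_iff.mp hytor, map_zero]
    obtain ⟨c, hc⟩ := hP₀gen (ψ y) hyred hytor'
    refine ⟨c, hψinj ?_⟩
    rw [map_nsmul, hψ x₀, hx₀val, ← hc]

end Summit.BirchSwinnertonDyer.BirchSwinnertonDyer.Theorems.FullDescentOrdinary
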